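import Summits.QuantumAdvantage.AdviceFreeQNC0.Elimination
import Summits.QuantumAdvantage.QuantumAdvantage.Theorems.CubicForrelationNearExactIsExactSecondWeightAll
import Summits.QuantumAdvantage.QuantumAdvantage.Theorems.CubicForrelationNearExactIsExactMinWeightFlat
import Literature.Computability.MetaComplexity.LowDegPolynomialRepresentation
import HarnessLib

/-!
# Cell vocabulary bridge: `HasDeg f d ↔ IsDegLeFun d f`, and the tree's Reed–Muller weight bricks
# (Kasami–Tokura second weight; minimum-weight words are flats) restated for `HasDeg`

Cell qa-qnc0 (route `QuantumAdvantage/RingFrame`, crux α `RingToElim` = stmt-QuantumAdvantage-19119), seat qa-qnc0-lit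
gen 10, for planner qa-qnc0-p2's ROUND-5 THEOREMS E2/E3 (ask R5-a `CostBoundCodegTwo`): the top-layer CLIQUE step of the
tensor line uses two printed Reed–Muller facts — "no weight of `RM(r,m)` strictly between `d = 2^{m−r}` and `1.5·d`"
[KasamiTokura1970 Thm 1 = MacWilliamsSloane1977 Ch. 15 §3 Thm 11(i)] and "minimum-weight codewords of `RM(r,m)` are the
incidence vectors of `(m−r)`-flats" [MacWilliamsSloane1977 Ch. 13 §4 Thm 8].  BOTH ARE ALREADY KERNEL THEOREMS in the tree,
proved for the sub-problem `CubicForrelation.NearExactIsExact` in the vocabulary `IsDegLeFun d e` (Boolean functions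
represented by an `MvPolynomial` of total degree `≤ d`):
`Summit.QuantumAdvantage.QuantumAdvantage.Theorems.CubicForrelation.NearExactIsExact.sw_second_weight_all` /
`sw_affine_card` / `mw_flat_of_minweight`.  The cell states degree through `HasDeg f d` := "the `0/1` indicator of `f`
lies in `Smolensky.lowDeg (ZMod 2) n d`" (`Elimination.lean`).  The Literature bridge
`isDegLeFun_iff_indicator_mem_lowDeg` (`Literature/Computability/MetaComplexity/LowDegPolynomialRepresentation.lean`)
identifies the two, so the bricks transfer with one-line proofs — nothing is re-proved here.

## Contents (all one-liners over the tree; no definitions, no facts)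

* `hasDeg_iff_isDegLeFun` — `HasDeg f d ↔ IsDegLeFun d f`.
* `two_pow_mul_card_support_eq` — Kasami–Tokura gap, `r ≥ 2`: `HasDeg c r`, `c ≠ 0`, `2^{r+1}·#supp c < 3·2^m` ⟹
  `2^r·#supp c = 2^m` (the support has exactly the minimum weight `2^{m−r}`).
* `card_support_affine` — `r = 1`: `#supp c ∈ {0, 2^m, 2^{m−1}}` (as `… ∨ … ∨ 2·# = 2^m`).
* `two_pow_mul_card_support_eq_one_le` — the gap for every `r ≥ 1` (combining the two).
* `support_eq_coset_periods_of_minweight` — minimum weight ⟹ the support is ONE coset `x₀ ⊕ V₀` of the xor-closed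
  group of periods `V₀ = {a : ∀ x, c (x ⊕ a) = c x}`, `#V₀ = #supp c` (an `(m−r)`-flat).
* `support_flat_of_lt_three_halves` — the form THEOREM E2/E3 consume: `r ≥ 1`, `HasDeg c r`, `c ≠ 0`,
  `2^{r+1}·#supp c < 3·2^m` ⟹ `2^r·#supp c = 2^m` AND the support is the flat `x₀ ⊕ V₀` as above.

WHAT THIS IS NOT: not THEOREM E2; no statement about crux α; separation NOT moved.
-/

namespace Summit.QuantumAdvantage.AdviceFreeQNC0

open Finset
open Literature.Computability.QuantumComplexity
open Literature.Computability.QuantumComplexity.BuzetChailloux (bxor zeroVec)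
open Summit.QuantumAdvantage.QuantumAdvantage.Theorems.CubicForrelation.NearExactIsExact
  (sw_second_weight_all sw_affine_card mw_flat_of_minweight)

variable {m : ℕ}

/-- **The cell's degree predicate is the tree's**: `HasDeg f d ↔ IsDegLeFun d f`.
[cite: Carlet2020, §2.2.1 Def. 6] -/
theorem hasDeg_iff_isDegLeFun (f : (Fin m → Bool) → Bool) (d : ℕ) : HasDeg f d ↔ IsDegLeFun d f :=
  (isDegLeFun_iff_indicator_mem_lowDeg d f).symm

/-- **Kasami–Tokura gap (`r ≥ 2`) in cell vocabulary**: a non-zero `c` with `HasDeg c r` and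
`2^{r+1}·#supp c < 3·2^m` has `2^r·#supp c = 2^m`. [cite: KasamiTokura1970, Thm 1]
[cite: MacWilliamsSloane1977, Ch. 15 §3 Thm 11(i)] -/
theorem two_pow_mul_card_support_eq {r : ℕ} (hr : 2 ≤ r) (c : (Fin m → Bool) → Bool) (hc : HasDeg c r)
    (hne : ∃ x, c x = true) (hlt : 2 ^ (r + 1) * #(univ.filter fun x => c x = true) < 3 * 2 ^ m) :
    2 ^ r * #(univ.filter fun x => c x = true) = 2 ^ m :=
  sw_second_weight_all r hr m c ((hasDeg_iff_isDegLeFun c r).1 hc) hne hlt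

/-- **Affine functions (`r = 1`)**: the support of `c` with `HasDeg c 1` is empty, everything, or a half.
[cite: MacWilliamsSloane1977, Ch. 13 §3 Thm 3 (weights of RM(1,m))] -/
theorem card_support_affine (c : (Fin m → Bool) → Bool) (hc : HasDeg c 1) :
    #(univ.filter fun x => c x = true) = 0 ∨ #(univ.filter fun x => c x = true) = 2 ^ m ∨
      2 * #(univ.filter fun x => c x = true) = 2 ^ m :=
  sw_affine_card c ((hasDeg_iff_isDegLeFun c 1).1 hc)

/-- **The gap for every `r ≥ 1`**: a non-zero `c` with `HasDeg c r` and `2^{r+1}·#supp c < 3·2^m` has exactly the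
minimum weight, `2^r·#supp c = 2^m`. [cite: KasamiTokura1970, Thm 1] [cite: MacWilliamsSloane1977, Ch. 15 §3 Thm 11(i)] -/
theorem two_pow_mul_card_support_eq_one_le {r : ℕ} (hr : 1 ≤ r) (c : (Fin m → Bool) → Bool) (hc : HasDeg c r)
    (hne : ∃ x, c x = true) (hlt : 2 ^ (r + 1) * #(univ.filter fun x => c x = true) < 3 * 2 ^ m) :
    2 ^ r * #(univ.filter fun x => c x = true) = 2 ^ m := by
  rcases Nat.lt_or_ge r 2 with h1 | h2
  · obtain rfl : r = 1 := le_antisymm (Nat.lt_succ_iff.1 h1) hr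
    have hpos : 0 < #(univ.filter fun x => c x = true) := by
      obtain ⟨x, hx⟩ := hne
      exact card_pos.2 ⟨x, mem_filter.2 ⟨mem_univ _, hx⟩⟩
    rcases card_support_affine c hc with h0 | hall | hhalf
    · omega
    · exfalso
      rw [hall] at hlt
      have : 2 ^ (1 + 1) * 2 ^ m = 4 * 2 ^ m := by norm_num
      omega
    · rw [pow_one]; exact hhalf
  · exact two_pow_mul_card_support_eq h2 c hc hne hlt

/-- **Minimum-weight words are flats, in cell vocabulary**: `HasDeg c (d+1)` and `2^{d+1}·#supp c = 2^m` ⟹ the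
periods `V₀ = {a : ∀ x, c (x ⊕ a) = c x}` contain `0`, are `⊕`-closed, `#V₀ = #supp c`, and `supp c = x₀ ⊕ V₀` for every
`x₀` in the support. [cite: MacWilliamsSloane1977, Ch. 13 §4 Thm 8] -/
theorem support_eq_coset_periods_of_minweight (d : ℕ) (c : (Fin m → Bool) → Bool) (hc : HasDeg c (d + 1))
    (hS : 2 ^ (d + 1) * #(univ.filter fun x => c x = true) = 2 ^ m) :
    zeroVec ∈ (univ.filter fun a : Fin m → Bool => ∀ x, c (bxor x a) = c x) ∧
    (∀ a ∈ (univ.filter fun a : Fin m → Bool => ∀ x, c (bxor x a) = c x),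
      ∀ b ∈ (univ.filter fun a : Fin m → Bool => ∀ x, c (bxor x a) = c x),
        bxor a b ∈ (univ.filter fun a : Fin m → Bool => ∀ x, c (bxor x a) = c x)) ∧
    #(univ.filter fun a : Fin m → Bool => ∀ x, c (bxor x a) = c x) = #(univ.filter fun x => c x = true) ∧
    ∀ x₀, c x₀ = true → (univ.filter fun x => c x = true) =
      (univ.filter fun a : Fin m → Bool => ∀ x, c (bxor x a) = c x).image (bxor x₀) :=
  mw_flat_of_minweight d c ((hasDeg_iff_isDegLeFun c (d + 1)).1 hc) hS

/-- **The form THEOREMS E2/E3 consume** (top-layer clique step): `r ≥ 1`, `HasDeg c r`, `c` non-zero and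
`2^{r+1}·#supp c < 3·2^m` ⟹ `#supp c` is the minimum weight (`2^r·# = 2^m`) and the support is the `(m−r)`-flat
`x₀ ⊕ V₀`, `V₀` the `⊕`-closed group of periods with `#V₀ = #supp c`.
[cite: KasamiTokura1970, Thm 1] [cite: MacWilliamsSloane1977, Ch. 13 §4 Thm 8; Ch. 15 §3 Thm 11(i)] -/
theorem support_flat_of_lt_three_halves {r : ℕ} (hr : 1 ≤ r) (c : (Fin m → Bool) → Bool) (hc : HasDeg c r)
    (hne : ∃ x, c x = true) (hlt : 2 ^ (r + 1) * #(univ.filter fun x => c x = true) < 3 * 2 ^ m) :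
    2 ^ r * #(univ.filter fun x => c x = true) = 2 ^ m ∧
    zeroVec ∈ (univ.filter fun a : Fin m → Bool => ∀ x, c (bxor x a) = c x) ∧
    (∀ a ∈ (univ.filter fun a : Fin m → Bool => ∀ x, c (bxor x a) = c x),
      ∀ b ∈ (univ.filter fun a : Fin m → Bool => ∀ x, c (bxor x a) = c x),
        bxor a b ∈ (univ.filter fun a : Fin m → Bool => ∀ x, c (bxor x a) = c x)) ∧
    #(univ.filter fun a : Fin m → Bool => ∀ x, c (bxor x a) = c x) = #(univ.filter fun x => c x = true) ∧
    ∀ x₀, c x₀ = true → (univ.filter fun x => c x = true) =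
      (univ.filter fun a : Fin m → Bool => ∀ x, c (bxor x a) = c x).image (bxor x₀) := by
  obtain ⟨d, rfl⟩ : ∃ d, r = d + 1 := ⟨r - 1, by omega⟩
  have hw := two_pow_mul_card_support_eq_one_le hr c hc hne hlt
  exact ⟨hw, support_eq_coset_periods_of_minweight d c hc hw⟩

end Summit.QuantumAdvantage.AdviceFreeQNC0
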